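import Summits.NavierStokesRegularity.NavierStokesRegularity.Theorems.OddMorawetzOddMorawetzLocalFixedB3Span
import Summits.NavierStokesRegularity.NavierStokesRegularity.Theorems.OddMorawetzOddMorawetzLocalE2Rotation
import Summits.NavierStokesRegularity.NavierStokesRegularity.Theorems.OddMorawetzOddMorawetzLocalE2Algebra
import Summits.NavierStokesRegularity.NavierStokesRegularity.Theorems.OddMorawetzOddMorawetzLocalIsoTransfer
import Summits.NavierStokesRegularity.NavierStokesRegularity.Theorems.OddMorawetzOddMorawetzLocalSmallLemmas
import HarnessLib

/-!
# An `O(3)`-fixed coefficient vector lies in the real span of the isotropic basis polynomials (stub `tau_eq_sum_iso`)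

Crux `OddMorawetzLocal` (item stmt-NavierStokesRegularity-1376), refutation skeleton (line `registered`), stub
`tau_eq_sum_iso` — the symmetry half of the final assembly.  Pure composition of landed theorems over the tree's
computable jet algebra (`OddMorawetzLocal/Negative/OddMorawetzLocalJetAlgebra`, `…RefutationDefs*`):
`fixed_b3_span` (`…FixedB3Span`), `signedPermMatrix_mem_and_apply` (`…SmallLemmas`),
`derMatrix_lieZ_mulVec_eq_zero` (`…E2Rotation`), `aMatrix_mulVec_eq` (`…E2Algebra`) and the reconstruction half
of `iso_transfer`, re-derived here from its public helpers `IsoTransfer.coeffOf_flatMap`,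
`IsoTransfer.sum_map_eq_sum_get`, `IsoTransfer.sortVars_of_mem_orbitExpansion`,
`IsoTransfer.sortVars_of_mem_isoPolyF` and `JPoly.coeffOf_normF` (`…IsoTransfer`, `…NormFSemantics`) because the
landed statement also demands the (here irrelevant) derivation check `derKillsF`.  Mathlib `Finset` / `Matrix` API;
no named facts, no new definitions.

After the isotropic reduction and `actMatrix_fixed_of_invariant`, the coefficient vector `τ : V k` of the
certificate density is fixed by `actMatrix k G` for every orthogonal `G`.  Then:

1. the 48 signed permutation matrices `signedPermMatrix σ ε` are orthogonal (`signedPermMatrix_mem_unitaryGroup`,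
   a Boolean-to-`ℤˣ` bridge to `signedPermMatrix_mem_and_apply`), so `fixed_b3_span` writes
   `τ = Σ_r c_r • vecOf (orbitSumN reps[r])` in the orbit coordinates `c`;
2. `(aMatrix k reps) c = derMatrix k lieZ (Σ_r c_r • vecOf (orbitSumN reps[r])) = derMatrix k lieZ τ = 0`
   (`aMatrix_mulVec_eq`, `derMatrix_lieZ_mulVec_eq_zero`);
3. the abstract kernel statement `hker` (the instantiated modular rank certificate) gives `c = Σ_l γ_l S_l` with
   `S_l = sVecD reps iso d l`;
4. substituting and exchanging the two finite sums, `τ = Σ_l γ_l • (Σ_r S_l r • vecOf (orbitSumN reps[r]))`, and the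
   inner sum is `vecOf (isoPolyF iso[l])` by the reconstruction check `orbitReconF` (`sum_sVecD_mul_vecOf`).
-/

noncomputable section

set_option linter.dupNamespace false
set_option autoImplicit false

namespace Summit.NavierStokesRegularity.NavierStokesRegularity.Theorems.OddMorawetz

open CoeffSemantics IsoTransfer

namespace TauEqSumIso

/-! ### Signed permutation matrices are orthogonal -/

/-- The signed permutation matrix `signedPermMatrix σ ε` (Boolean signs) is the matrix of
`signedPermMatrix_mem_and_apply` for the unit signs `ε' i = if ε i then 1 else -1`. -/
theorem signedPermMatrix_eq_of_units (σ : Equiv.Perm (Fin 3)) (ε : Fin 3 → Bool) :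
    (signedPermMatrix σ ε : Matrix (Fin 3) (Fin 3) ℝ) =
      Matrix.of fun i j : Fin 3 =>
        if j = σ.symm i then (((if ε i then (1 : ℤˣ) else -1 : ℤˣ) : ℤ) : ℝ) else 0 := by
  ext i j
  simp only [signedPermMatrix, Matrix.of_apply]
  by_cases hj : j = σ.symm i
  · rw [if_pos hj, if_pos hj]
    cases ε i <;> simp
  · rw [if_neg hj, if_neg hj]

/-- Every signed permutation matrix lies in `O(3) = Matrix.unitaryGroup (Fin 3) ℝ`. -/
theorem signedPermMatrix_mem_unitaryGroup (σ : Equiv.Perm (Fin 3)) (ε : Fin 3 → Bool) :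
    (signedPermMatrix σ ε : Matrix (Fin 3) (Fin 3) ℝ) ∈ Matrix.unitaryGroup (Fin 3) ℝ := by
  rw [signedPermMatrix_eq_of_units]
  exact (signedPermMatrix_mem_and_apply σ fun i => if ε i then (1 : ℤˣ) else -1).1

/-! ### The reconstruction check, unfolded (part 2 of `iso_transfer` without the derivation check) -/

/-- **The reconstruction check at the level of coefficients.**  For a polynomial `q` with sorted monomials,
`orbitReconF reps q` expands every coefficient of `q` along the normalised orbit sums of the representatives:
`coeffOf q μ = Σ_r coeffOf q reps[r] · coeffOf (orbitSumN reps[r]) μ`. -/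
theorem coeffOf_eq_sum_of_orbitReconF (reps : List (List JVar)) (q : JPoly ℤ)
    (hqs : ∀ t ∈ q, sortVars t.2 = t.2) (h₂ : orbitReconF reps q = true) (μ : List JVar) :
    JPoly.coeffOf q μ =
      ∑ r : Fin reps.length, JPoly.coeffOf q (reps.get r) * JPoly.coeffOf (orbitSumN (reps.get r)) μ := by
  -- adapted from `IsoTransfer.kernel_checks` (second part), which additionally demands `derKillsF`
  unfold orbitReconF at h₂
  have h : JPoly.normF q = JPoly.normF (reps.flatMap fun m =>
      if JPoly.coeffOf q m = 0 then [] else JPoly.smul (JPoly.coeffOf q m) (orbitSumN m)) :=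
    of_decide_eq_true h₂
  rw [← JPoly.coeffOf_normF q hqs μ, h,
    JPoly.coeffOf_normF _ (sortVars_of_mem_orbitExpansion reps (JPoly.coeffOf q)) μ, coeffOf_flatMap,
    sum_map_eq_sum_get]
  refine Finset.sum_congr rfl fun r _ => ?_
  split_ifs with hc
  · rw [hc, zero_mul, coeffOf_nil]
  · exact coeffOf_smul _ _ _

/-- **Reconstruction in coordinates.**  If every descriptor of `iso` passes `orbitReconF reps`, then recombining the
coefficient vectors of the normalised orbit sums with the weights `sVecD reps iso d l` gives back the coefficient
vector of the iso polynomial `isoPolyF iso[l]` (part 2 of `iso_transfer`, without its `derKillsF` hypothesis). -/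
theorem sum_sVecD_mul_vecOf (k : ℕ) (reps : List (List JVar)) (iso : List IsoDesc) (d : ℕ) (hd : iso.length = d)
    (hrec : ∀ q ∈ iso, orbitReconF reps (isoPolyF q) = true) (l : Fin d) (i : Fin (idx k).length) :
    (∑ r, ((sVecD reps iso d l r : ℤ) : ℝ) * ((vecOf k (orbitSumN (reps.get r)) i : ℤ) : ℝ)) =
      ((vecOf k (isoPolyF (iso.getD l.val (.poly []))) i : ℤ) : ℝ) := by
  have hmem : iso.getD l.val (.poly []) ∈ iso := by
    have hl : l.val < iso.length := l.isLt.trans_eq hd.symm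
    rw [List.getD_eq_getElem _ _ hl]
    exact List.getElem_mem hl
  have hexp := coeffOf_eq_sum_of_orbitReconF reps _ (sortVars_of_mem_isoPolyF _) (hrec _ hmem) ((idx k).get i)
  unfold sVecD vecOf
  have h := congrArg (Int.cast : ℤ → ℝ) hexp
  push_cast at h
  exact h.symm

end TauEqSumIso

open TauEqSumIso

/-! ### The registered stub -/

/-- **Stub `tau_eq_sum_iso` of crux `OddMorawetzLocal` (refutation, assembly core).**  An `O(3)`-fixed coefficient
vector `τ : V k` lies in the real span of the coefficient vectors of the isotropic basis polynomials
`isoPolyF iso[l]`, given (a) the orbit certificate `he` (every orbit sum of a basis monomial is `[]` or a multiple of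
the normalised orbit sum of a LISTED representative), (b) the reconstruction checks `hrec` of the iso descriptors,
and (c) the kernel statement `hker`: the real kernel of the integer derivation matrix `aMatrix k reps` is spanned by
the iso vectors in orbit coordinates `sVecD reps iso d l`. -/
theorem tau_eq_sum_iso (k : ℕ) (τ : V k)
    (hfix : ∀ G ∈ Matrix.unitaryGroup (Fin 3) ℝ, (actMatrix k (G : Matrix (Fin 3) (Fin 3) ℝ)).mulVec τ = τ)
    (reps : List (List JVar)) (hr : ∀ m ∈ reps, m ∈ idx k)
    (he : ∀ i : Fin (idx k).length, orbitSum ((idx k).get i) = [] ∨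
      ∃ (r : ℕ) (c : ℤ), r < reps.length ∧ reps.getD r [] = (minImage ((idx k).get i)).2 ∧
        orbitSum ((idx k).get i) = JPoly.smul c (orbitSumN (reps.getD r [])))
    (iso : List IsoDesc) (d : ℕ) (hd : iso.length = d)
    (hrec : ∀ q ∈ iso, orbitReconF reps (isoPolyF q) = true)
    (hker : ∀ c : Fin reps.length → ℝ, ((aMatrix k reps).map (Int.cast : ℤ → ℝ)).mulVec c = 0 →
      ∃ γ : Fin d → ℝ, c = ∑ l, γ l • fun r => ((sVecD reps iso d l r : ℤ) : ℝ)) :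
    ∃ γ : Fin d → ℝ, τ = ∑ l, γ l • fun i => ((vecOf k (isoPolyF (iso.getD l.val (.poly []))) i : ℤ) : ℝ) := by
  -- (1) `τ` in orbit coordinates: the `B₃`-span lemma, fed with the orthogonal signed permutation matrices
  obtain ⟨c, hc⟩ := fixed_b3_span k reps τ he fun g _ =>
    hfix _ (signedPermMatrix_mem_unitaryGroup g.1 g.2)
  have hc' : τ = ∑ r, c r • fun i => ((vecOf k (orbitSumN (reps.get r)) i : ℤ) : ℝ) := hc
  -- (2) the orbit coordinates lie in the kernel of the derivation matrix
  have hA : ((aMatrix k reps).map (Int.cast : ℤ → ℝ)).mulVec c = 0 := by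
    rw [aMatrix_mulVec_eq k reps hr c, ← hc']
    exact derMatrix_lieZ_mulVec_eq_zero k τ hfix
  -- (3) the kernel is spanned by the iso vectors in orbit coordinates
  obtain ⟨γ, hγ⟩ := hker c hA
  refine ⟨γ, ?_⟩
  -- (4) substitute and exchange the sums; the inner sums are the iso coefficient vectors
  have hcr : ∀ r, c r = ∑ l, γ l * ((sVecD reps iso d l r : ℤ) : ℝ) := fun r => by
    rw [hγ]
    simp only [Finset.sum_apply, Pi.smul_apply, smul_eq_mul]
  rw [hc']
  funext i
  simp only [Finset.sum_apply, Pi.smul_apply, smul_eq_mul]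
  simp_rw [hcr, ← sum_sVecD_mul_vecOf k reps iso d hd hrec, Finset.sum_mul, Finset.mul_sum, mul_assoc]
  exact Finset.sum_comm

end Summit.NavierStokesRegularity.NavierStokesRegularity.Theorems.OddMorawetz

end
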